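import Literature.Computability.QuantumComplexity.HadamardGadgetStates
import Literature.Computability.QuantumComplexity.HadamardGadgetIQP
import HarnessLib

/-!
# The Hadamard-gadget compiler: Clifford+T circuits to post-selected IQP circuits

Topic `Literature/Computability/QuantumComplexity`; second file of the discharge of the named fact
`PostBQPWith_subset_PostIQPWith` (`PostBQPToPostIQP.lean`), after `HadamardGadgetStates.lean`.
Source: M. J. Bremner, R. Jozsa, D. J. Shepherd, Proc. R. Soc. A 467 (2011) 459–472 =
arXiv:1005.1407, proof of Thm. 1 (p. 7): every line of the given circuit is made to begin and end
with `H`, and every intermediate `H` is replaced by the Hadamard gadget (a `CZ` onto a fresh line,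
the final `H` and the post-selection `0` of the old line), "performing this replacement for every
intermediate `H` gate results in an IQP circuit with some extra post-selections … with the same
output conditional probabilities".

This file DEFINES the compiled circuit, in a layout chosen so that its description is a
syntax-directed transcription of the given one (the subject of the uniformity files): **every
logical qubit hops at every step**, so that the physical wire of logical qubit `i` at stage `s` is
the explicit number `posNat N s i = i + 2^L · s` (`N = n + m` logical qubits, `2^L ≥ N + 2`,
`HGadget.Hop.stride`), whose binary numeral is the `L`-bit numeral of `i` followed by that of `s`.

## Relation to `HadamardGadget.lean` / `HadamardGadgetIQP.lean` (the other line in `HGadget`)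

The tree carries a second formalisation of the same proof: `HGadget.run` (`HadamardGadget.lean`)
is BJS's rewriting *verbatim* — one fresh variable per intermediate `H`, a table `cur` of the
current variable of every line — with the path-sum identity `HGadget.pathSum_final`, and
`HadamardGadgetIQP.lean` proves the amplitude identity `HGadget.iqpAmplitude_gadget` for an arbitrary
`HGadget.Layout`. The present line (sub-namespace `HGadget.Hop`: this file,
`HadamardGadgetSimulation.lean`, `HadamardGadgetFamily.lean`, and the uniformity files
`HadamardGadgetLexer/Asm/…`) exists for the *uniformity* half: a polynomial-time machine printing the
description of `HGadget.run C` must maintain the table `cur` with random access (exactly the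
bookkeeping that `ForrelationThm25Sign.lean` had to design away for the Forrelation reduction),
whereas the circuit defined here is a DIFFERENT compilation of `C` — every line hops twice per
micro-operation, `H_a` being realised as `S · hop · S · hop · S` so that all lines stay at the same
stage — whose wires are closed arithmetic expressions, printed by a one-pass stack machine that
only pads and appends numerals. Being a different circuit, it is not an instance of
`HGadget.gadgetOps`, and its simulation theorem is proved directly (state-vector calculus of
`HadamardGadgetStates.lean`, `HadamardGadgetSimulation.lean`) rather than through
`iqpAmplitude_gadget`. What this line shares with the other: the phase semantics of `{Z, CZ, T}`
circuits (`Literature.Barriers.QuantumAdvantage.gatePhase`/`circPhase`/`mat_eq_diagonal`/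
`norm_circPhase`) and the placed-gate emitters `HGadget.realizeOp` (our `czN p q`, `tN p`, `zN p` ARE
`realizeOp W (.CZ p q)`, `realizeOp W (.T p)`, `realizeOp W (.Z p)`, with their phases read off
`HGadget.prod_gatePhase_realizeOp`); the layout, the blocks and everything downstream are specific
to this line. Either line, completed by uniformity, discharges the named fact; this one is the line
whose uniformity machine is being built.

* `HGadget.Hop.MicroOp`, `HGadget.Hop.microOps`: a Clifford+T gate as micro-operations over
  `{T, S, H, CZ}` (`CNOT_{cd} = H_d CZ_{cd} H_d`);
* the emitted gate lists over `iqpDiag = {Z, CZ, T}` on `W` wires, all indexed by plain wire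
  NUMBERS (`czN`, `tN`, `zN`; out-of-range numbers emit nothing, a junk case never met):
  the hop layer `hopN N s` (`CZ(pos s i, pos (s+1) i)` for `i < N`), the block `blockN N s op` of a
  micro-operation at stage `s` (two hop layers; `H_a` is `S · hop · S · hop · S` on the wire of `a`,
  `S H S H S = e^{iπ/4} H`; `S = T T`), `blocksN` (stage advancing by `2` per micro-operation), the
  initial layer `initN` (input wire `i < n` hops from its home `i`, ancilla qubit `n + j` from its
  home `pos 1 (n+j)`, both to stage `2`), the final layer `finalN` (qubit `0` to the output wire `n`,
  qubit `1` to the wire `n + 1` which then carries a `Z` — BJS's post-selection wire reads `1`, the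
  tree's `PostIQPFamily` post-selects `0` —, the other qubits to stage `s_f + 1`, ignored);
* `HGadget.Hop.gadgetGates`, `HGadget.Hop.gadgetCircuit C : QCircuit iqpDiag (n + ancillas n m C)` with
  `n + ancillas = 2^L (s_f + 1) + N`, `s_f = finalStage C = 2 + 2 · #micro-operations`, and the size
  `HGadget.Hop.postLen` of the post-selection block (`n + 1, …, 2^L (s_f + 1) + 1`);
* the **phase semantics** of the emitted lists: `listPhase gs := circPhase ⟨gs⟩` with the tree's
  `Literature.Barriers.QuantumAdvantage.gatePhase`/`circPhase`/`mat_eq_diagonal`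
  (`UncorrectedNoiseIQP.lean`: a circuit over `{Z, CZ, T}` is the diagonal matrix of the product of
  its gate phases, oracle gates being the identity under the empty oracle — so the order of emission
  is immaterial to the semantics), and the phases of the emitted pieces (`listPhase_czN`,
  `listPhase_tN`, `listPhase_zN`, from `HGadget.prod_gatePhase_realizeOp`; `listPhase_hopN`);
* the wire embeddings of the layout (`stageEmb`, `homeEmb`, `finalEmb`) with their ranges and
  disjointness.

The simulation theorem (the compiled circuit reproduces the post-selected statistics of `C` up
to the factor `2^{-#spent wires}`) is the sequel `HadamardGadgetSimulation.lean`.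

## References

* M. J. Bremner, R. Jozsa, D. J. Shepherd, Proc. R. Soc. A 467 (2011) 459–472, arXiv:1005.1407,
  Thm. 1 and its proof (p. 7, Fig. 1), Def. 3 and §2.3 (IQP circuits in `Z`-basis form).
* M. A. Nielsen, I. L. Chuang, *Quantum Computation and Quantum Information*, CUP 2010, §4.2
  (`S = T²`, `H`, `CZ`), §4.3 Ex. 4.17 (`CNOT = H CZ H`).
-/

noncomputable section

namespace Literature.Computability.QuantumComplexity

open Matrix Cryptography Finset
open Literature.Barriers.QuantumAdvantage (gatePhase circPhase mat_eq_diagonal norm_gatePhase norm_circPhase)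

namespace HGadget.Hop

/-! ### The layout -/

/-- `L`: the number of bits reserved for a logical wire index in this file's layout,
`L = size (N + 1)`, so that `2^L ≥ N + 2`. [folklore] -/
def bitLen (N : ℕ) : ℕ := Nat.size (N + 1)

/-- The stride `2^L` between consecutive stages of this file's layout. [folklore] -/
def stride (N : ℕ) : ℕ := 2 ^ bitLen N

/-- `N + 1 < 2^L`: a stage block holds the `N` logical wires, and the wires `n`, `n + 1` lie below
the first block. [folklore] -/
theorem lt_stride (N : ℕ) : N + 1 < stride N := Nat.lt_size_self _

/-- `N < 2^L`. [folklore] -/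
theorem lt_stride' (N : ℕ) : N < stride N := lt_of_le_of_lt (Nat.le_succ N) (lt_stride N)

/-- The stride is positive. [folklore] -/
theorem stride_pos (N : ℕ) : 0 < stride N := pow_pos (by norm_num) _

/-- **The physical wire of logical qubit `i` at stage `s`** in this file's layout: `i + 2^L · s`
(BJS's "extra qubit line", at a computed position). [folklore] -/
def posNat (N s i : ℕ) : ℕ := i + stride N * s

/-- Wires of one stage are below the next stage. [folklore] -/
theorem posNat_lt_mul_succ {N s i : ℕ} (hi : i < N) : posNat N s i < stride N * (s + 1) := by
  have := lt_stride' N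
  unfold posNat; nlinarith

/-- Wires of stage `s` are at least `2^L · s`. [folklore] -/
theorem mul_le_posNat (N s i : ℕ) : stride N * s ≤ posNat N s i := Nat.le_add_left _ _

/-- `posNat` is injective in the qubit. [folklore] -/
theorem posNat_injective (N s : ℕ) : Function.Injective (posNat N s) := fun i j h => by
  unfold posNat at h; omega

/-- Wires of distinct stages are distinct. [folklore] -/
theorem posNat_ne_of_lt {N s s' i i' : ℕ} (hi : i < N) (hs : s < s') : posNat N s i ≠ posNat N s' i' := by
  intro h
  have h1 := posNat_lt_mul_succ (s := s) hi
  have h2 := mul_le_posNat N s' i'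
  have h3 : stride N * (s + 1) ≤ stride N * s' := Nat.mul_le_mul_left _ hs
  omega

/-! ### Micro-operations -/

/-- The micro-operations the compiler works with: the diagonal `T`, `S`, `CZ` and the Hadamard `H`
on logical qubits. [cite: BremnerJozsaShepherdPRSA2011, Thm. 1 (proof: gate set `H, Z, CZ, P`)] -/
inductive MicroOp (N : ℕ)
  /-- `T` on qubit `a`. -/
  | T (a : Fin N)
  /-- `S = T²` on qubit `a`. -/
  | S (a : Fin N)
  /-- `H` on qubit `a`. -/
  | H (a : Fin N)
  /-- `CZ` on the distinct qubits `a`, `b`. -/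
  | CZ (a b : Fin N) (h : a ≠ b)

/-- A Clifford+T gate as micro-operations: `H`, `S`, `T` verbatim, `CNOT_{cd} = H_d · CZ_{cd} · H_d`
(Nielsen–Chuang Ex. 4.17); oracle gates (absent from the families at hand) yield nothing.
[cite: NielsenChuang2010, §4.3 Ex. 4.17] -/
def microOps {N : ℕ} : QGate cliffordT N → List (MicroOp N)
  | .gate .H e => [.H (embH e 0)]
  | .gate .S e => [.S (embS e 0)]
  | .gate .T e => [.T (embT e 0)]
  | .gate .CNOT e => [.H (embC e 1), .CZ (embC e 0) (embC e 1) (emb_two_ne (embC e)), .H (embC e 1)]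
  | .oracle _ _ => []

/-- The micro-operations of a circuit, in order. [cite: BremnerJozsaShepherdPRSA2011, Thm. 1 (proof)] -/
def microList {N : ℕ} (C : QCircuit cliffordT N) : List (MicroOp N) := C.gates.flatMap microOps

/-- The final stage `s_f = 2 + 2 · #micro-operations`: the logical register is at stage `2` after the
initial layer and every micro-operation advances it by two stages. [cite: BremnerJozsaShepherdPRSA2011, Thm. 1 (proof)] -/
def finalStage {N : ℕ} (C : QCircuit cliffordT N) : ℕ := 2 + 2 * (microList C).length

/-- The number of ancilla wires of the compiled circuit, whose wires are `0, …, 2^L (s_f + 1) + N - 1`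
(the stages `0, …, s_f` in full, and the `N` wires of stage `s_f + 1`).
[cite: BremnerJozsaShepherdPRSA2011, Thm. 1 (proof)] -/
def ancillas (n m : ℕ) (C : QCircuit cliffordT (n + m)) : ℕ := stride (n + m) * (finalStage C + 1) + m

/-- The size of the ancilla post-selection block `n + 1, …, 2^L (s_f + 1) + 1`: every wire except the
output wire `n` and the ignored block of stage `s_f + 1` (from its third wire on).
[cite: BremnerJozsaShepherdPRSA2011, Def. 3 (post-selection register)] -/
def postLen (n m : ℕ) (C : QCircuit cliffordT (n + m)) : ℕ := stride (n + m) * (finalStage C + 1) + 1 - n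

/-- The width of the compiled circuit is `2^L (s_f + 1) + N`. [folklore] -/
theorem width_eq (n m : ℕ) (C : QCircuit cliffordT (n + m)) :
    n + ancillas n m C = stride (n + m) * (finalStage C + 1) + (n + m) := by
  unfold ancillas; omega

/-! ### Emitters (wires by number) -/

section emit

variable {W : ℕ}

/-- `CZ` between the wires numbered `p ≠ q`: the other line's `HGadget.realizeOp W (.CZ p q)` (nothing
if out of range or equal — never the case in the compiled circuit, see `posNat_lt_width`).
[cite: BremnerJozsaShepherdPRSA2011, Thm. 1 (proof, the `CZ_{ae}` of the gadget)] -/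
abbrev czN (p q : ℕ) : List (QGate iqpDiag W) := realizeOp W (.CZ p q)

/-- `T` on the wire numbered `p`: `HGadget.realizeOp W (.T p)`. [cite: NielsenChuang2010, §4.2] -/
abbrev tN (p : ℕ) : List (QGate iqpDiag W) := realizeOp W (.T p)

/-- `Z` on the wire numbered `p`: `HGadget.realizeOp W (.Z p)`. [cite: NielsenChuang2010, §4.2] -/
abbrev zN (p : ℕ) : List (QGate iqpDiag W) := realizeOp W (.Z p)

/-- **The hop layer at stage `s`**: `CZ(pos s i, pos (s+1) i)` for every logical qubit `i < N` — one
Hadamard gadget per line, the fresh line of qubit `i` being its wire at the next stage.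
[cite: BremnerJozsaShepherdPRSA2011, Thm. 1 (proof, Fig. 1)] -/
def hopN (N s : ℕ) : List (QGate iqpDiag W) :=
  (List.range N).flatMap fun i => czN (posNat N s i) (posNat N (s + 1) i)

/-- **The block of a micro-operation at stage `s`** (the register ends at stage `s + 2`):
`T_a`: `T` on the wire of `a`, hop, hop; `S_a`: `T T`, hop, hop; `CZ_{ab}`: `CZ`, hop, hop;
`H_a`: `TT`, hop, `TT` (on the new wire of `a`), hop, `TT` — i.e. `S H S H S = e^{iπ/4} H` on qubit
`a` and `H H = 1` on the others. [cite: BremnerJozsaShepherdPRSA2011, Thm. 1 (proof)] -/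
def blockN (N s : ℕ) : MicroOp N → List (QGate iqpDiag W)
  | .T a => tN (posNat N s a) ++ hopN N s ++ hopN N (s + 1)
  | .S a => tN (posNat N s a) ++ tN (posNat N s a) ++ hopN N s ++ hopN N (s + 1)
  | .H a => tN (posNat N s a) ++ tN (posNat N s a) ++ hopN N s ++
      (tN (posNat N (s + 1) a) ++ tN (posNat N (s + 1) a)) ++ hopN N (s + 1) ++
      (tN (posNat N (s + 2) a) ++ tN (posNat N (s + 2) a))
  | .CZ a b _ => czN (posNat N s a) (posNat N s b) ++ hopN N s ++ hopN N (s + 1)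

/-- The blocks of a list of micro-operations from stage `s` on, two stages each.
[cite: BremnerJozsaShepherdPRSA2011, Thm. 1 (proof)] -/
def blocksN (N : ℕ) : ℕ → List (MicroOp N) → List (QGate iqpDiag W)
  | _, [] => []
  | s, op :: ops => blockN N s op ++ blocksN N (s + 2) ops

/-- **The initial layer**: input qubit `i < n` hops from its home wire `i`, ancilla qubit `n + j`
from its home wire `pos 1 (n + j)`, all to stage `2` (the first Hadamard of every line of the given
circuit is the initial Hadamard of the IQP circuit, BJS §2.3; the hop undoes it on the data).
[cite: BremnerJozsaShepherdPRSA2011, Thm. 1 (proof) and §2.3] -/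
def initN (n m : ℕ) : List (QGate iqpDiag W) :=
  ((List.range n).flatMap fun i => czN i (posNat (n + m) 2 i)) ++
    ((List.range m).flatMap fun j => czN (posNat (n + m) 1 (n + j)) (posNat (n + m) 2 (n + j)))

/-- The target of the final hop of qubit `i` from stage `s`: the output wire `n` for qubit `0`, the
wire `n + 1` for qubit `1`, stage `s + 1` for the others. [cite: BremnerJozsaShepherdPRSA2011, Def. 3 (output and post-selection registers)] -/
def finalTgt (n m s i : ℕ) : ℕ := if i = 0 then n else if i = 1 then n + 1 else posNat (n + m) (s + 1) i

/-- **The final layer** from stage `s`: every qubit hops once more (so that it is measured in the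
computational basis after the final Hadamards), qubit `0` onto the output wire `n`, qubit `1` onto
`n + 1`, which then gets a `Z` (flipping BJS's post-selected value `1` to the tree's `0`:
`H Z H = X`). [cite: BremnerJozsaShepherdPRSA2011, Thm. 1 (proof) and Def. 3] -/
def finalN (n m s : ℕ) : List (QGate iqpDiag W) :=
  ((List.range (n + m)).flatMap fun i => czN (posNat (n + m) s i) (finalTgt n m s i)) ++ zN (n + 1)

/-- **The gate list of the compiled circuit**: initial layer, the blocks of the micro-operations from
stage `2`, final layer. [cite: BremnerJozsaShepherdPRSA2011, Thm. 1 (proof)] -/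
def gadgetGates {n m : ℕ} (C : QCircuit cliffordT (n + m)) : List (QGate iqpDiag W) :=
  initN n m ++ blocksN (n + m) 2 (microList C) ++ finalN n m (finalStage C)

end emit

/-- **The compiled post-selected IQP circuit** (its diagonal part) of a Clifford+T circuit `C` on
`n + m` wires. [cite: BremnerJozsaShepherdPRSA2011, Thm. 1 (proof)] -/
def gadgetCircuit {n m : ℕ} (C : QCircuit cliffordT (n + m)) : QCircuit iqpDiag (n + ancillas n m C) :=
  ⟨gadgetGates C⟩

/-! ### Phase semantics of the emitted lists -/

section phase

variable {W : ℕ}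

/-- **The phase of a gate list**: the tree's `circPhase` of the circuit it forms (the product of the
`gatePhase`s of `UncorrectedNoiseIQP.lean`; oracle gates, never emitted, have phase `1`).
[cite: BremnerJozsaShepherdPRSA2011, §2.3 (gates diagonal in the `Z` basis)] -/
abbrev listPhase (gs : List (QGate iqpDiag W)) (z : QReg W) : ℂ := circPhase ⟨gs⟩ z

/-- Phase of the empty list. [folklore] -/
@[simp] theorem listPhase_nil (z : QReg W) : listPhase ([] : List (QGate iqpDiag W)) z = 1 := rfl

/-- Phase of a cons. [folklore] -/
@[simp] theorem listPhase_cons (g : QGate iqpDiag W) (gs : List (QGate iqpDiag W)) (z : QReg W) :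
    listPhase (g :: gs) z = gatePhase g z * listPhase gs z := rfl

/-- Phase of a concatenation. [folklore] -/
@[simp] theorem listPhase_append (gs gs' : List (QGate iqpDiag W)) (z : QReg W) :
    listPhase (gs ++ gs') z = listPhase gs z * listPhase gs' z := by
  simp [listPhase, circPhase, List.prod_append]

/-- Phase of a `flatMap`: the product over the list. [folklore] -/
theorem listPhase_flatMap {ι : Type*} (l : List ι) (f : ι → List (QGate iqpDiag W)) (z : QReg W) :
    listPhase (l.flatMap f) z = (l.map fun i => listPhase (f i) z).prod := by
  induction l with
  | nil => rfl
  | cons a l ih => rw [List.flatMap_cons, listPhase_append, ih, List.map_cons, List.prod_cons]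

/-- **The compiled circuit is the diagonal of its phase** (the tree's `mat_eq_diagonal`).
[cite: BremnerJozsaShepherdPRSA2011, §2.3 (commuting gates "may be applied simultaneously")] -/
theorem mat_gadgetCircuit {n m : ℕ} (C : QCircuit cliffordT (n + m)) :
    (gadgetCircuit C).mat = Matrix.diagonal (listPhase (gadgetGates C)) := mat_eq_diagonal _

/-! ### Phases of the emitted pieces (from `HGadget.prod_gatePhase_realizeOp`) -/

/-- Phase of an in-range operation of the other line's `DOp`, as a `listPhase`. [folklore] -/
theorem listPhase_realizeOp {op : DOp} (hop : op.Below W) (z : QReg W) :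
    listPhase (realizeOp W op) z = op.phase (uAt z) :=
  prod_gatePhase_realizeOp hop z

/-- Phase of `czN p q` for in-range distinct wires: `(-1)^{z_p z_q}`. [cite: NielsenChuang2010, §4.2] -/
theorem listPhase_czN {p q : ℕ} (hp : p < W) (hq : q < W) (hpq : p ≠ q) (z : QReg W) :
    listPhase (czN p q) z = if (z ⟨p, hp⟩ && z ⟨q, hq⟩) = true then -1 else 1 := by
  rw [czN, listPhase_realizeOp (op := .CZ p q) ⟨hp, hq, hpq⟩, DOp.phase, uAt_of_lt _ hp, uAt_of_lt _ hq]
  simp only [Bool.and_eq_true]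

/-- Phase of `tN p` for an in-range wire: `ω^{z_p}`. [cite: NielsenChuang2010, §4.2] -/
theorem listPhase_tN {p : ℕ} (hp : p < W) (z : QReg W) :
    listPhase (tN p) z = if z ⟨p, hp⟩ = true then omega else 1 := by
  rw [tN, listPhase_realizeOp (op := .T p) hp, DOp.phase, uAt_of_lt _ hp]

/-- Phase of `zN p` for an in-range wire: `(-1)^{z_p}`. [cite: NielsenChuang2010, §4.2] -/
theorem listPhase_zN {p : ℕ} (hp : p < W) (z : QReg W) :
    listPhase (zN p) z = if z ⟨p, hp⟩ = true then -1 else 1 := by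
  rw [zN, listPhase_realizeOp (op := .Z p) hp, DOp.phase, uAt_of_lt _ hp]

/-- The product of a function over `List.range N` is the product over `Fin N`. [folklore] -/
theorem prod_map_range_eq_prod_univ {M : Type*} [CommMonoid M] (N : ℕ) (f : ℕ → M) :
    ((List.range N).map f).prod = ∏ i : Fin N, f i := by
  rw [← List.prod_toFinset _ (List.nodup_range) , List.toFinset_range, Fin.prod_univ_eq_prod_range]

end phase

/-! ### The wire embeddings of the layout -/

section layout

variable {n m : ℕ} (C : QCircuit cliffordT (n + m))

/-- The width `W = n + ancillas` of the compiled circuit (reducible abbreviation). [folklore] -/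
abbrev width : ℕ := n + ancillas n m C

/-- Every wire of a stage `s ≤ s_f + 1` is a wire of the compiled circuit. [folklore] -/
theorem posNat_lt_width {s i : ℕ} (hs : s ≤ finalStage C + 1) (hi : i < n + m) :
    posNat (n + m) s i < width C := by
  rw [width, width_eq]
  have : stride (n + m) * s ≤ stride (n + m) * (finalStage C + 1) := Nat.mul_le_mul_left _ hs
  unfold posNat; omega

/-- **The stage embedding**: logical qubit `i` at stage `s` sits on the wire `posNat N s i`.
[cite: BremnerJozsaShepherdPRSA2011, Thm. 1 (proof)] -/
def stageEmb (s : ℕ) (hs : s ≤ finalStage C + 1) : Fin (n + m) ↪ Fin (width C) :=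
  ⟨fun i => ⟨posNat (n + m) s i, posNat_lt_width C hs i.2⟩, fun _ _ h =>
    Fin.ext (posNat_injective (n + m) s (congrArg Fin.val h))⟩

/-- The wire number of the stage embedding. [folklore] -/
@[simp] theorem stageEmb_val (s : ℕ) (hs : s ≤ finalStage C + 1) (i : Fin (n + m)) :
    ((stageEmb C s hs i : Fin (width C)) : ℕ) = posNat (n + m) s i := rfl

/-- The output wire `n` and the wire `n + 1` lie below the first stage block. [folklore] -/
theorem n_succ_lt_stride : n + 1 < stride (n + m) := by have := lt_stride (n + m); omega

/-- `n + 1` is a wire of the compiled circuit. [folklore] -/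
theorem n_succ_lt_width : n + 1 < width C := by
  rw [width, width_eq]
  have h1 := n_succ_lt_stride (n := n) (m := m)
  have h2 : stride (n + m) ≤ stride (n + m) * (finalStage C + 1) := Nat.le_mul_of_pos_right _ (by omega)
  omega

/-- The home wire number of logical qubit `i`: the input wire `i` itself for `i < n`, the wire of
stage `1` for an ancilla qubit. [cite: BremnerJozsaShepherdPRSA2011, Thm. 1 (proof)] -/
def homeNat (n m i : ℕ) : ℕ := if i < n then i else posNat (n + m) 1 i

/-- Home wires are wires of the compiled circuit. [folklore] -/
theorem homeNat_lt_width {i : ℕ} (hi : i < n + m) : homeNat n m i < width C := by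
  unfold homeNat
  split_ifs with h
  · have := n_succ_lt_width C; omega
  · exact posNat_lt_width C (by unfold finalStage; omega) hi

/-- `homeNat` is injective on `i < N`. [folklore] -/
theorem homeNat_injective {i j : ℕ} (h : homeNat n m i = homeNat n m j) : i = j := by
  unfold homeNat posNat at h
  have := lt_stride' (n + m)
  split_ifs at h <;> omega

/-- **The home embedding** (stage `0` of the input qubits, stage `1` of the ancilla qubits).
[cite: BremnerJozsaShepherdPRSA2011, Thm. 1 (proof)] -/
def homeEmb : Fin (n + m) ↪ Fin (width C) :=
  ⟨fun i => ⟨homeNat n m i, homeNat_lt_width C i.2⟩, fun _ _ h => Fin.ext (homeNat_injective (congrArg Fin.val h))⟩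

/-- The wire number of the home embedding. [folklore] -/
@[simp] theorem homeEmb_val (i : Fin (n + m)) : ((homeEmb C i : Fin (width C)) : ℕ) = homeNat n m i := rfl

/-- Final targets are wires of the compiled circuit. [folklore] -/
theorem finalTgt_lt_width {i : ℕ} (hi : i < n + m) : finalTgt n m (finalStage C) i < width C := by
  unfold finalTgt
  split_ifs with h0 h1
  · have := n_succ_lt_width C; omega
  · exact n_succ_lt_width C
  · exact posNat_lt_width C le_rfl hi

/-- `finalTgt` is injective on `i < N`. [folklore] -/
theorem finalTgt_injective {i j : ℕ} (h : finalTgt n m (finalStage C) i = finalTgt n m (finalStage C) j) : i = j := by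
  unfold finalTgt posNat at h
  have h1 := n_succ_lt_stride (n := n) (m := m)
  have h2 : stride (n + m) ≤ stride (n + m) * (finalStage C + 1 + 1) := Nat.le_mul_of_pos_right _ (by omega)
  split_ifs at h <;> first | omega | (rw [Nat.mul_add, Nat.mul_one] at h; omega)

/-- **The final embedding**: qubit `0` on the output wire `n`, qubit `1` on `n + 1`, qubit `i ≥ 2`
on its wire of stage `s_f + 1`. [cite: BremnerJozsaShepherdPRSA2011, Def. 3 (output and post-selection registers)] -/
def finalEmb : Fin (n + m) ↪ Fin (width C) :=
  ⟨fun i => ⟨finalTgt n m (finalStage C) i, finalTgt_lt_width C i.2⟩, fun _ _ h =>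
    Fin.ext (finalTgt_injective C (congrArg Fin.val h))⟩

/-- The wire number of the final embedding. [folklore] -/
@[simp] theorem finalEmb_val (i : Fin (n + m)) : ((finalEmb C i : Fin (width C)) : ℕ) = finalTgt n m (finalStage C) i := rfl

/-- **The low set of stage `s`**: the wires that may have been spent when the register is at stage
`s ≥ 2` — input wires and the wires of the stages `1, …, s - 1`. [folklore] -/
def LowWire (n m s : ℕ) (w : ℕ) : Prop := w < n ∨ (stride (n + m) ≤ w ∧ w < stride (n + m) * s)

/-- Wires of a stage `s ≥ 1` are not low at any stage `s' ≤ s`. [folklore] -/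
theorem not_lowWire_posNat {s i : ℕ} (s' : ℕ) (hs1 : 1 ≤ s) (hs : s' ≤ s) :
    ¬ LowWire n m s' (posNat (n + m) s i) := by
  unfold LowWire posNat
  have h1 := n_succ_lt_stride (n := n) (m := m)
  have h2 : stride (n + m) * s' ≤ stride (n + m) * s := Nat.mul_le_mul_left _ hs
  have h3 : stride (n + m) * 1 ≤ stride (n + m) * s := Nat.mul_le_mul_left _ hs1
  omega

/-- Wires of stage `s` are low at every later stage (for `s ≥ 1`). [folklore] -/
theorem lowWire_posNat {s s' i : ℕ} (hs : 1 ≤ s) (hss' : s < s') (hi : i < n + m) : LowWire n m s' (posNat (n + m) s i) := by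
  right
  have h1 : stride (n + m) * 1 ≤ stride (n + m) * s := Nat.mul_le_mul_left _ hs
  exact ⟨by rw [Nat.mul_one] at h1; exact le_trans h1 (mul_le_posNat _ _ _),
    lt_of_lt_of_le (posNat_lt_mul_succ hi) (Nat.mul_le_mul_left _ hss')⟩

/-- The output wire `n` and the wire `n + 1` are never low. [folklore] -/
theorem not_lowWire_n (s : ℕ) : ¬ LowWire n m s n ∧ ¬ LowWire n m s (n + 1) := by
  unfold LowWire
  have := n_succ_lt_stride (n := n) (m := m)
  constructor <;> omega

/-- Home wires are low at stage `2`. [folklore] -/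
theorem lowWire_homeNat {i : ℕ} (hi : i < n + m) : LowWire n m 2 (homeNat n m i) := by
  unfold homeNat
  split_ifs with h
  · exact Or.inl h
  · exact lowWire_posNat le_rfl (by norm_num) hi

/-- `LowWire` is monotone in the stage. [folklore] -/
theorem LowWire.mono {s s' w : ℕ} (h : LowWire n m s w) (hs : s ≤ s') : LowWire n m s' w := by
  rcases h with h | ⟨h1, h2⟩
  · exact Or.inl h
  · exact Or.inr ⟨h1, lt_of_lt_of_le h2 (Nat.mul_le_mul_left _ hs)⟩

end layout

/-! ### Phases of the layers in terms of the embeddings -/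

section layerPhases

variable {n m : ℕ} (C : QCircuit cliffordT (n + m))

/-- Phase of a `flatMap` over `List.range N` as a product over `Fin N`. [folklore] -/
theorem listPhase_flatMap_range {W N : ℕ} (F : ℕ → List (QGate iqpDiag W)) (G : Fin N → ℂ) (z : QReg W)
    (hFG : ∀ i : Fin N, listPhase (F i) z = G i) :
    listPhase ((List.range N).flatMap F) z = ∏ i : Fin N, G i := by
  rw [listPhase_flatMap, prod_map_range_eq_prod_univ N (fun i => listPhase (F i) z)]
  exact Finset.prod_congr rfl fun i _ => hFG i

/-- **Phase of the hop layer**: the `CZ`-layer phase between the stage embeddings `s` and `s + 1`.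
[cite: BremnerJozsaShepherdPRSA2011, Thm. 1 (proof, Fig. 1)] -/
theorem listPhase_hopN (s : ℕ) (hs : s ≤ finalStage C + 1) (hs' : s + 1 ≤ finalStage C + 1) (z : QReg (width C)) :
    listPhase (hopN (n + m) s) z = czLayerPhase (stageEmb C s hs) (stageEmb C (s + 1) hs') z := by
  rw [hopN, czLayerPhase_apply]
  refine listPhase_flatMap_range _ _ z fun i => ?_
  rw [listPhase_czN (posNat_lt_width C hs i.2) (posNat_lt_width C hs' i.2)
    (posNat_ne_of_lt (N := n + m) i.2 (Nat.lt_succ_self s))]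
  rfl

/-- **Phase of the initial layer**: the `CZ`-layer phase between the home embedding and stage `2`.
[cite: BremnerJozsaShepherdPRSA2011, Thm. 1 (proof)] -/
theorem listPhase_initN (h2 : 2 ≤ finalStage C + 1) (z : QReg (width C)) :
    listPhase (initN n m) z = czLayerPhase (homeEmb C) (stageEmb C 2 h2) z := by
  rw [initN, listPhase_append, czLayerPhase_apply, Fin.prod_univ_add]
  congr 1
  · refine listPhase_flatMap_range _ _ z fun i => ?_
    have hi : (i : ℕ) < n + m := by omega
    have hne : (i : ℕ) ≠ posNat (n + m) 2 i := by unfold posNat; have := stride_pos (n + m); omega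
    rw [listPhase_czN (by have := n_succ_lt_width C; omega) (posNat_lt_width C h2 hi) hne]
    have hhome : (homeEmb C (Fin.castAdd m i) : Fin (width C)) = ⟨i, by have := n_succ_lt_width C; omega⟩ := by
      ext; simp [homeNat]
    rw [hhome]
    rfl
  · refine listPhase_flatMap_range _ _ z fun j => ?_
    have hj : n + (j : ℕ) < n + m := by omega
    rw [listPhase_czN (posNat_lt_width C (by omega) hj) (posNat_lt_width C h2 hj)
      (posNat_ne_of_lt (N := n + m) hj (by norm_num))]
    have hhome : (homeEmb C (Fin.natAdd n j) : Fin (width C)) = ⟨posNat (n + m) 1 (n + j), posNat_lt_width C (by omega) hj⟩ := by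
      ext; simp [homeNat]
    rw [hhome]
    rfl

/-- **Phase of the final layer**: the `CZ`-layer phase between stage `s_f` and the final embedding,
times the `Z` phase of the wire `n + 1`. [cite: BremnerJozsaShepherdPRSA2011, Thm. 1 (proof) and Def. 3] -/
theorem listPhase_finalN (z : QReg (width C)) :
    listPhase (finalN n m (finalStage C)) z =
      czLayerPhase (stageEmb C (finalStage C) (Nat.le_succ _)) (finalEmb C) z *
        (if z ⟨n + 1, n_succ_lt_width C⟩ = true then -1 else 1) := by
  rw [finalN, listPhase_append, listPhase_zN (n_succ_lt_width C), czLayerPhase_apply]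
  congr 1
  refine listPhase_flatMap_range _ _ z fun i => ?_
  have hne : posNat (n + m) (finalStage C) i ≠ finalTgt n m (finalStage C) i := by
    unfold finalTgt
    have h1 := n_succ_lt_stride (n := n) (m := m)
    have h2 : stride (n + m) * 1 ≤ stride (n + m) * finalStage C :=
      Nat.mul_le_mul_left _ (by unfold finalStage; omega)
    have h3 := mul_le_posNat (n + m) (finalStage C) i
    split_ifs
    · omega
    · omega
    · exact posNat_ne_of_lt i.2 (Nat.lt_succ_self _)
  rw [listPhase_czN (posNat_lt_width C (Nat.le_succ _) i.2) (finalTgt_lt_width C i.2) hne]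
  rfl

/-- The `T` phase `ω^{y_a}` of logical qubit `a`. [cite: NielsenChuang2010, §4.2] -/
def tPh {N : ℕ} (a : Fin N) (y : QReg N) : ℂ := if y a = true then omega else 1

/-- The `S` phase `i^{y_a} = (ω^{y_a})²` of logical qubit `a`. [cite: NielsenChuang2010, §4.2] -/
def sPh {N : ℕ} (a : Fin N) (y : QReg N) : ℂ := tPh a y * tPh a y

/-- The `CZ` phase `(-1)^{y_a y_b}`. [cite: NielsenChuang2010, §4.2] -/
def czPh {N : ℕ} (a b : Fin N) (y : QReg N) : ℂ := if (y a && y b) = true then -1 else 1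

/-- The logical phase applied by the block of a micro-operation at its first stage. [cite: BremnerJozsaShepherdPRSA2011, Thm. 1 (proof)] -/
def microδ₀ {N : ℕ} : MicroOp N → QReg N → ℂ
  | .T a => tPh a
  | .S a => sPh a
  | .H a => sPh a
  | .CZ a b _ => czPh a b

/-- The logical phase applied by the block of a micro-operation at its middle stage. [cite: BremnerJozsaShepherdPRSA2011, Thm. 1 (proof)] -/
def microδ₁ {N : ℕ} : MicroOp N → QReg N → ℂ
  | .H a => sPh a
  | _ => fun _ => 1

/-- The logical phase applied by the block of a micro-operation at its last stage. [cite: BremnerJozsaShepherdPRSA2011, Thm. 1 (proof)] -/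
def microδ₂ {N : ℕ} : MicroOp N → QReg N → ℂ
  | .H a => sPh a
  | _ => fun _ => 1

/-- Phase of `tN` on the stage wire of qubit `a`. [folklore] -/
theorem listPhase_tN_stage (s : ℕ) (hs : s ≤ finalStage C + 1) (a : Fin (n + m)) (z : QReg (width C)) :
    listPhase (tN (posNat (n + m) s a)) z = tPh a (z ∘ stageEmb C s hs) := by
  rw [listPhase_tN (posNat_lt_width C hs a.2)]
  rfl

/-- Phase of `czN` on the stage wires of qubits `a ≠ b`. [folklore] -/
theorem listPhase_czN_stage (s : ℕ) (hs : s ≤ finalStage C + 1) {a b : Fin (n + m)} (hab : a ≠ b) (z : QReg (width C)) :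
    listPhase (czN (posNat (n + m) s a) (posNat (n + m) s b)) z = czPh a b (z ∘ stageEmb C s hs) := by
  rw [listPhase_czN (posNat_lt_width C hs a.2) (posNat_lt_width C hs b.2)
    (fun h => hab (Fin.ext (posNat_injective _ _ h)))]
  rfl

/-- **Phase of a block.** The block of a micro-operation at stage `s` has the phase
`δ₀(z|ₛ) · χ_{s,s+1}(z) · δ₁(z|ₛ₊₁) · χ_{s+1,s+2}(z) · δ₂(z|ₛ₊₂)` with the hop-layer phases `χ` and the
logical phases `δ` of the micro-operation. [cite: BremnerJozsaShepherdPRSA2011, Thm. 1 (proof)] -/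
theorem listPhase_blockN (s : ℕ) (h0 : s ≤ finalStage C + 1) (h1 : s + 1 ≤ finalStage C + 1)
    (h2 : s + 2 ≤ finalStage C + 1) (op : MicroOp (n + m)) (z : QReg (width C)) :
    listPhase (blockN (n + m) s op) z =
      microδ₀ op (z ∘ stageEmb C s h0) * czLayerPhase (stageEmb C s h0) (stageEmb C (s + 1) h1) z *
        microδ₁ op (z ∘ stageEmb C (s + 1) h1) * czLayerPhase (stageEmb C (s + 1) h1) (stageEmb C (s + 2) h2) z *
          microδ₂ op (z ∘ stageEmb C (s + 2) h2) := by
  cases op with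
  | T a =>
    simp only [blockN, listPhase_append, listPhase_tN_stage C s h0, listPhase_hopN C s h0 h1,
      listPhase_hopN C (s + 1) h1 h2, microδ₀, microδ₁, microδ₂]
    ring
  | S a =>
    simp only [blockN, listPhase_append, listPhase_tN_stage C s h0, listPhase_hopN C s h0 h1,
      listPhase_hopN C (s + 1) h1 h2, microδ₀, microδ₁, microδ₂, sPh]
    ring
  | H a =>
    simp only [blockN, listPhase_append, listPhase_tN_stage C s h0, listPhase_tN_stage C (s + 1) h1,
      listPhase_tN_stage C (s + 2) h2, listPhase_hopN C s h0 h1, listPhase_hopN C (s + 1) h1 h2,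
      microδ₀, microδ₁, microδ₂, sPh]
  | CZ a b hab =>
    simp only [blockN, listPhase_append, listPhase_czN_stage C s h0 hab, listPhase_hopN C s h0 h1,
      listPhase_hopN C (s + 1) h1 h2, microδ₀, microδ₁, microδ₂]
    ring

end layerPhases

end HGadget.Hop

end Literature.Computability.QuantumComplexity
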